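import Summits.HubbardSuperconductivity.HubbardSuperconductivity.Theorems.WidthHaldaneBridgeSharpBloch

/-!
# `stub_kineticFloor` of line `Sketch` (crux `WidthHaldaneBridge`, stmt-HubbardSuperconductivity-16311)

The registered stub `stub_kineticFloor` of the skeleton `Cruxes/WidthHaldaneBridge/Lines/Sketch.lean`
is the implication "sharp Bloch price ⇒ (under `UniformThermo`) the kinetic floor `d₀·L·M ≤ K_ψ` of
every normalised sector ground state". Its conclusion was landed unconditionally, minutes before the
skeleton was registered, as `kineticFloor` (`Theorems/WidthHaldaneKineticFloor.lean`, which proves the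
sharp price `two_mul_tubeEnergy_le_kinetic` inside); the hypothesis of the stub is the landed
`stub_sharpBloch` (`Theorems/WidthHaldaneBridgeSharpBloch.lean`). This file only records the registered
closed form, so that the skeleton's sorry is discharged BY NAME; nothing new is proved.

Reference: D. J. Scalapino, S. R. White, S. C. Zhang, PRB 47 (1993) 7995, §II (`D_s/π ≤ ⟨-k_x⟩`).
-/

noncomputable section

namespace Summit.HubbardSuperconductivity.HubbardSuperconductivity.Theorems.WidthHaldane

set_option linter.dupNamespace false -- summit = problem name (single-conjunct summit), D-0017

open scoped BigOperators Classical Matrix ComplexConjugate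
open Matrix Literature.MathematicalPhysics.QuantumLattice

/-- **`stub_kineticFloor`** (registered stub of crux stmt-HubbardSuperconductivity-16311, line `Sketch` /
card `twist-transfer-floors`): the sharp Bloch price (hypothesis; landed as `stub_sharpBloch`) and
`UniformThermo` with `d₀ > 0` give the kinetic floor `d₀·L·M ≤ Σ_{a,b,σ} Re⟨ψ, (c†_{(a,b)σ}c_{(a-1,b)σ}
+ h.c.) ψ⟩` for every normalised sector ground state of every admissible untwisted tube — the landed
`kineticFloor`, the hypothesis being unused. [cite: ScalapinoWhiteZhang1993, §II] -/
theorem stub_kineticFloor :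
    (∀ (L M : ℕ) [NeZero L] [NeZero M] (Λ : Type) [LinearOrder Λ] [Fintype Λ] (e : Λ ≃ ZMod L × ZMod M),
      3 ≤ L → ∀ (U θ : ℝ) (N : ℕ) (ψ : Fock (Orb Λ)), ψ ∈ szSector N 0 → star ψ ⬝ᵥ ψ = 1 →
        tubeEnergy L M Λ e U θ N ≤
          (expect (tubeH0 L M Λ e U) ψ).re +
            (1 - Real.cos (θ / L)) *
              ∑ a : ZMod L, ∑ b : ZMod M, ∑ σ : Fin 2,
                (expect (creation (orb (e.symm (a, b)) σ) * annihilation (orb (e.symm (a - 1, b)) σ) +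
                  creation (orb (e.symm (a - 1, b)) σ) * annihilation (orb (e.symm (a, b)) σ)) ψ).re) →
    ∀ (U δ d₀ k₀ : ℝ) (M₁ L₀ : ℕ), 0 < d₀ → UniformThermo U δ d₀ k₀ M₁ L₀ →
      ∀ (L M : ℕ) [NeZero L] [NeZero M], Even L → Even M → M₁ ≤ M → M ≤ L → L₀ ≤ L → 3 ≤ L →
        ∀ (Λ : Type) [LinearOrder Λ] [Fintype Λ] (e : Λ ≃ ZMod L × ZMod M) (ψ : Fock (Orb Λ)),
          star ψ ⬝ᵥ ψ = 1 → IsGroundStateInSector (tubeH0 L M Λ e U) (tubeFilling L M δ) 0 ψ →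
            d₀ * (L : ℝ) * (M : ℝ) ≤
              ∑ a : ZMod L, ∑ b : ZMod M, ∑ σ : Fin 2,
                (expect (creation (orb (e.symm (a, b)) σ) * annihilation (orb (e.symm (a - 1, b)) σ) +
                  creation (orb (e.symm (a - 1, b)) σ) * annihilation (orb (e.symm (a, b)) σ)) ψ).re :=
  fun _ => kineticFloor

end Summit.HubbardSuperconductivity.HubbardSuperconductivity.Theorems.WidthHaldane

end
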